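import Summits.ResolutionOfSingularities.ResolutionOfSingularities.Theorems.PlanarPortFunctor2
import HarnessLib

/-!
# PlanarPortClasses — decomp-res node «PlanarPort» (lens-5 g24, critic row 165), tree file 3/3 of the node

Content VERBATIM from the decomp-res lens-5 g24 node `HOME/decomp-res-lens-5/g24/PlanarPort.lean` rev 0 (pin
814caf7a; HOME = run/shared/lean/pub/decomp-res;
critic row 165 CLEARED MAP +1 · DECIDED 0; landing orders INBOX :677) — provenance, critic text and the lens header
in full in the first file of the node,
`PlanarPortFunctor`.  Namespace `…Theorems.PlanarPort`; `--supports stmt-ResolutionOfSingularities-31770`; in the Theses cone.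

## This file

§4 TAIL (carried here, cut from `PlanarPortFunctor2` by the 400-line cap; same `section Law` replayed with its
variables): `translated_letter`, `layer_zero_not_monomialLed`.  Then §5 of the node = the critic's slice
`g24/parts/PlanarPortClasses.lean` (e6aa67c7): the CLASSES — the H-P-decided piece
`NoNonTerminalSectionPlanarJointTailsDeep` (DERIVED in kernel from the two named propositions:
**`nonTerminalSection_of_HP (hP3 : HP24Prop3) (hP4 : HP24Prop4)`** — the H-P half CLOSED modulo [HP24] Prop. 3 + 4),
the LOCATED RESIDUAL **`NoTerminalSectionPlanarJointTailsDeep`** (monomial planar tails with recurrently TERMINAL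
plane section; binder (L) «layer 0 not monomial-led» supplied by the law), the necessities
`nonTerminalSection_of_monomialLed` / `terminalSection_of_monomialLed`, the EXACT hypothesis-free split of the port
class **`monomialLed_iff_nonTerminal_terminal : CoefficientCut.NoMonomialLedPlanarJointTailsDeep ↔
NoNonTerminalSection… ∧ NoTerminalSection…`** (splits route item 28121 `CFNoMonomialLedPlanarJointTailsDeep`
EXACTLY), `terminalSection_of_defectWalksDeep` / `nonTerminalSection_of_defectWalksDeep`, THE NODE EQUATION
`defectWalksDeep_iff_planarPort`, and **`closes_planarPort`** / `closes_planarPort_leaves` /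
`defectWalksDeep_iff_of_HP` — `MaxContactCut.DefectWalksDeep` (31770) BY NAME through the tree's
`CoefficientCut.closes_led`.  ONE TEXT FIX at landing (critic row 165 h1, docstring of
`NoTerminalSectionPlanarJointTailsDeep` only): «POINTER(cite …)» instead of «COSTUME(cite …)» — the cited print
([BenitoVillamayor2012] §4, [KawanoueMatsuki2016] §5, [HP24] §3 p. 775) are POINTERS for this leaf, not ports.

[WRITER NOTE (decomp-res writer g10): file split only (tree files ≤ 400 lines); namespace, sections, section
variables and every declaration exactly as in
the lens (the lens's global dupNamespace-linter line is dropped — the library sets it).  DEDUP (gate `dedup.landed`,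
p803047): the lens's two-line
helper `degree_two` restates the landed Literature theorem
`Literature.RingTheory.MvPolynomial.Ruppert.degree_fin_two` — the copy is dropped and its two use sites
(`degree_secExp'`, `degree_liftExp`) cite the Literature theorem by its full name; import
`Literature/RingTheory/MvPolynomial/RuppertMatrix` added.]

(Sources: HauserPerlega2024 (Publ. RIMS 60; Prop. 3 p. 791, Prop. 4 p. 793, §3 p. 775, §7 p. 788); Perlega2017
(arXiv:2011.14443) §7.3; Hauser2010Kangaroo; BenitoVillamayor2012 §4; KawanoueMatsuki2016 §5; Moh1987; CossartPiltant2008 §2.)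
-/

open MvPolynomial Finset
open Literature.AlgebraicGeometry.Resolution
open Literature.AlgebraicGeometry.Resolution.Hauser2010
open Literature.AlgebraicGeometry.Resolution.HauserPerlega2024
open Literature.AlgebraicGeometry.Resolution.PointBlowup
open Literature.AlgebraicGeometry.Resolution.WeightedBlowup
open Summit.ResolutionOfSingularities.ResolutionOfSingularities.Theses
open Summit.ResolutionOfSingularities.ResolutionOfSingularities.Theorems.TightDefectClasses
open Summit.ResolutionOfSingularities.ResolutionOfSingularities.Theorems.TightDefectStrongWalks
open Summit.ResolutionOfSingularities.ResolutionOfSingularities.Theorems.ItineraryCutClasses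
open Summit.ResolutionOfSingularities.ResolutionOfSingularities.Theorems.ProximityCut
open Summit.ResolutionOfSingularities.ResolutionOfSingularities.Theorems.ExitLaw
open Summit.ResolutionOfSingularities.ResolutionOfSingularities.Theorems.PlanarCut
open Summit.ResolutionOfSingularities.ResolutionOfSingularities.Theorems.CoefficientCut

namespace Summit.ResolutionOfSingularities.ResolutionOfSingularities.Theorems.PlanarPort

section Law

variable {K : Type} [Field K] [DecidableEq K]
variable {i j k : Fin 3} (hij : i ≠ j) (hjk : j ≠ k) (hik : i ≠ k)
include hij hjk hik
variable {q : ℕ} {s₀ : State (Fin 3) K}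

omit [DecidableEq K] in
/-- A non-zero translation vector of a planar move is non-zero on the plane letter other than the chart. [folklore] -/
theorem translated_letter {b : Fin 3 → K} (hb : b ≠ 0) {l : Fin 3} (hbl : b l = 0) (hbk : b k = 0) (hl : l = i ∨ l = j) :
    (l = j ∧ b i ≠ 0) ∨ (l = i ∧ b j ≠ 0) := by
  rcases hl with rfl | rfl
  · right
    refine ⟨rfl, fun hbj => hb (funext fun m => ?_)⟩
    rcases fin3_cases ⟨hij, hjk, hik⟩ m with rfl | rfl | rfl
    · exact hbl
    · exact hbj
    · exact hbk
  · left
    refine ⟨rfl, fun hbi => hb (funext fun m => ?_)⟩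
    rcases fin3_cases ⟨hij, hjk, hik⟩ m with rfl | rfl | rfl
    · exact hbi
    · exact hbl
    · exact hbk

/-- **THE LAW, walk form (PROVED): along a planar tail (wall `u_k`) in the monomial regime with non-empty wall layer `0`
and infinitely many translated moves, the wall layer `0` is NEVER monomial-led.**  (Were it monomial-led at some `t ≥ N`,
LAW B would keep it so through the untranslated moves and LAW A would forbid every translated one.) [new] [folklore] -/
theorem layer_zero_not_monomialLed (hs : IsRoot q s₀) (W : ForcedWalk q s₀) {N : ℕ}
    (hP : ∀ t, N ≤ t → W.j t ≠ k ∧ W.b t k = 0) (h0 : ∀ t, N ≤ t → ∃ d ∈ (W.st t).F.support, d k = 0)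
    (hdead : ∀ t, N ≤ t → ∀ a, 1 ≤ a → a < q → sm (layer k a (W.st t).F) i j = 0)
    (hb : ∀ M : ℕ, ∃ t, M ≤ t ∧ W.b t ≠ 0) : ∀ t, N ≤ t → sm (layer k 0 (W.st t).F) i j ≠ 0 := by
  classical
  have hF : ∀ t, ∀ d ∈ (W.st t).F.support, q ≤ d.degree := fun t d hd => le_degree_of_mem_support hs W t hd
  have hclean : ∀ t, deletePthPowers q (W.st t).F = (W.st t).F := fun t => walk_clean hs W t
  have hne : ∀ t, N ≤ t → (layer k 0 (W.st t).F).Nonempty := by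
    intro t ht
    obtain ⟨d, hd, hk⟩ := h0 t ht
    exact ⟨d, mem_layer.mpr ⟨MvPolynomial.mem_support_iff.mp hd, hk⟩⟩
  have hchart : ∀ t, N ≤ t → W.j t = i ∨ W.j t = j := by
    intro t ht
    rcases fin3_cases ⟨hij, hjk, hik⟩ (W.j t) with h | h | h
    · exact Or.inl h
    · exact Or.inr h
    · exact absurd h (hP t ht).1
  -- one step: a monomial-led wall layer 0 forces an untranslated move and is kept
  have hstep : ∀ t, N ≤ t → sm (layer k 0 (W.st t).F) i j = 0 →
      W.b t = 0 ∧ sm (layer k 0 (W.st (t + 1)).F) i j = 0 := by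
    intro t ht hsm
    have hF' : ∀ d ∈ (step q (W.j t) (W.b t) (W.st t)).F.support, q ≤ d.degree := by
      have := hF (t + 1); rwa [W.st_succ] at this
    have hiso : IsolatedTop q (step q (W.j t) (W.b t) (W.st t)).F := by
      have := W.isolated (t + 1); rwa [W.st_succ] at this
    have hb0 : W.b t = 0 := by
      by_contra hbt
      rcases translated_letter hij hjk hik hbt (W.onExc t) (hP t ht).2 (hchart t ht) with ⟨hl, hbi⟩ | ⟨hl, hbj⟩
      · rw [hl] at hF' hiso
        exact not_monomialLed_zero_of_translated hij hjk hik q (W.b t) (by rw [← hl]; exact W.onExc t) (hP t ht).2 hbi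
          (W.st t) (hF t) hF' (hclean t) (hdead t ht) (hne t ht) hsm (by rw [← hl]; exact W.equimult t) hiso
      · rw [hl] at hF' hiso
        exact not_monomialLed_zero_of_translated hij.symm hik hjk q (W.b t) (by rw [← hl]; exact W.onExc t) (hP t ht).2
          hbj (W.st t) (hF t) hF' (hclean t) (fun a ha1 haq => by rw [sm_comm]; exact hdead t ht a ha1 haq) (hne t ht)
          (by rw [sm_comm]; exact hsm) (by rw [← hl]; exact W.equimult t) hiso
    refine ⟨hb0, ?_⟩
    rw [W.st_succ, hb0]
    rcases hchart t ht with hl | hl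
    · rw [hl, sm_comm]
      exact monomialLed_zero_step_of_untranslated hij.symm hik hjk q (W.st t) (hF t) (hclean t) (by rw [sm_comm]; exact hsm)
    · rw [hl]
      exact monomialLed_zero_step_of_untranslated hij hjk hik q (W.st t) (hF t) (hclean t) hsm
  intro t₀ ht₀ hsm₀
  have hall : ∀ t, t₀ ≤ t → sm (layer k 0 (W.st t).F) i j = 0 := by
    intro t ht
    induction t, ht using Nat.le_induction with
    | base => exact hsm₀
    | succ t ht ih => exact (hstep t (le_trans ht₀ ht) ih).2
  obtain ⟨t, ht, hbt⟩ := hb t₀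
  exact hbt (hstep t (le_trans ht₀ ht) (hall t ht)).1

end Law

section Classes

/-! ## §5 The classes: the Hauser–Perlega half of the planar port, the located terminal residual, the EXACT split -/

/-- RESIDUAL CLASS · H-P HALF · **MONOMIAL PLANAR TAILS WITH EVENTUALLY NON-TERMINAL PLANE SECTION.**  VERBATIM the port
class `CoefficientCut.NoMonomialLedPlanarJointTailsDeep` (all its binders, same `N`) plus ONE binder: from `N` on the
SECTION STATE `secState i j k (W.st t)` — the wall layer `0` of `F_t` read in the two plane letters over `K̄`, with the
plane's exceptional letters — is NOT in a terminal case of [HP24] §3 up to a subordinate triangular change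
(`HauserPerlega2024.IsTerminalSub`).  DERIVED IN KERNEL from the two named propositions of [HP24]
(`nonTerminalSection_of_HP`: Prop. 3 gives the flag invariant of every section state, Prop. 4 makes it drop at every move
of the section walk — which IS a two-letter model walk: `secState_step_F`, `excLetters_secState_step`,
`isEquimultiplePoint_secState` — and `Triple` is well-ordered).  Tags: FACT-MOD(HauserPerlega2024 Prop. 3 p. 791 +
Prop. 4 p. 793, typed) · WEAKER (sub-case of the port class BY LETTER, `nonTerminalSection_of_monomialLed`; probe P1
must-fail) · CLOSED modulo the two named propositions. -/
def NoNonTerminalSectionPlanarJointTailsDeep : Prop :=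
  ∀ p : ℕ, p.Prime → ∀ e : ℕ, 2 ≤ e → ∀ (K : Type) [Field K] [CharP K p] [PerfectField K] [DecidableEq K]
    (s₀ : State (Fin 3) K), IsRoot (p ^ e) s₀ → ∀ W : ForcedWalk (p ^ e) s₀, (∀ i, 1 ≤ (W.st i).shade) →
    ∀ N : ℕ, (∀ t, N ≤ t → (W.st (t + 1)).shade = (W.st t).shade) →
    (∀ t, N ≤ t → ordZero (W.st t).F ≠ ((p ^ e : ℕ) : ℕ∞)) →
    (∀ M : ℕ, ∃ t, M ≤ t ∧ StaysOnNewest W t) → (∀ M : ℕ, ∃ t, M ≤ t ∧ W.b t ≠ 0) →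
    ∀ (i j k : Fin 3), i ≠ j → j ≠ k → i ≠ k → (∀ t, N ≤ t → W.j t ≠ k ∧ W.b t k = 0) →
    (∀ t, N ≤ t → ∃ d ∈ (W.st t).F.support, d k = 0) →
    (∀ t, N ≤ t → ∀ a, 1 ≤ a → a < p ^ e →
      IsMonomialLed (((W.st t).F.support).filter (fun d => d k = a)) i j) →
    (∀ t, N ≤ t → ¬ IsTerminalSub (p ^ e) (excLetters (secState i j k (W.st t))) (secState i j k (W.st t)).F) → False

/-- NECESSITY: the H-P half is a sub-case of the port class BY LETTER. [folklore] -/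
theorem nonTerminalSection_of_monomialLed (h : NoMonomialLedPlanarJointTailsDeep) :
    NoNonTerminalSectionPlanarJointTailsDeep :=
  fun p hp e he K _ _ _ _ s₀ hs W hsh N hpl hex hS hb i j k hij hjk hik hP h0 hled _ =>
    h p hp e he K s₀ hs W hsh N hpl hex hS hb i j k hij hjk hik hP h0 hled

/-- **THE PORT, HAUSER–PERLEGA HALF (PROVED modulo the two named propositions of [HP24]):** along a monomial planar tail
whose plane section is never terminal from `N` on, the section states form a walk of the two-letter model `Z^{p^e} + G(X₀,X₁)`
over `K̄` (point blow-ups at equimultiple points, cleaned, order `> p^e`, exceptional letters transported), so [HP24] Prop. 3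
attaches a flag invariant to every section state and Prop. 4 makes it drop strictly at every move — an infinite strictly
decreasing sequence in the well-ordered `ℕ ×ₗ ℕ ×ₗ ℕ∞`. [new] [folklore] -/
theorem nonTerminalSection_of_HP (hP3 : HP24Prop3) (hP4 : HP24Prop4) : NoNonTerminalSectionPlanarJointTailsDeep := by
  intro p hp e he K _ _ _ _ s₀ hs W hsh N hpl hex hS hb i j k hij hjk hik hP h0 hled hNT
  classical
  letI : DecidableEq (Kbar K) := Classical.decEq _
  have he1 : 1 ≤ e := by omega
  have hF : ∀ t, ∀ d ∈ (W.st t).F.support, p ^ e ≤ d.degree := fun t d hd => le_degree_of_mem_support hs W t hd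
  have hclean : ∀ t, deletePthPowers (p ^ e) (W.st t).F = (W.st t).F := fun t => walk_clean hs W t
  have hord : ∀ t, N ≤ t → ((p ^ e : ℕ) : ℕ∞) < ordZero (W.st t).F := by
    intro t ht
    obtain ⟨o, ho, hqo⟩ := walk_nat hs W t
    have hne := hex t ht
    rw [ho] at hne ⊢
    have : p ^ e ≠ o := fun h => hne (by rw [h])
    exact_mod_cast lt_of_le_of_ne hqo this
  have hchart : ∀ t, N ≤ t → W.j t = i ∨ W.j t = j := by
    intro t ht
    rcases fin3_cases ⟨hij, hjk, hik⟩ (W.j t) with h | h | h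
    · exact Or.inl h
    · exact Or.inr h
    · exact absurd h (hP t ht).1
  -- the section walk
  set G : ℕ → State (Fin 2) (Kbar K) := fun t => secState i j k (W.st t) with hG
  have hGne : ∀ t, N ≤ t → (G t).F ≠ 0 := fun t ht => secState_F_ne_zero hij hjk hik (h0 t ht)
  have hGclean : ∀ t, deletePthPowers (p ^ e) (G t).F = (G t).F := fun t =>
    secState_clean hij hjk hik (p ^ e) (hclean t)
  have hGord : ∀ t, N ≤ t → ((p ^ e : ℕ) : ℕ∞) < ordZero (G t).F := fun t ht =>
    lt_of_lt_of_le (hord t ht) (le_ordZero_secState hij hjk hik (W.st t))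
  have hstepF : ∀ t, N ≤ t →
      (G (t + 1)).F = (step (p ^ e) (idx i (W.j t)) (ι K ∘ secPt i j (W.b t)) (G t)).F := by
    intro t ht
    show (secState i j k (W.st (t + 1))).F = _
    rw [W.st_succ]
    exact secState_step_F hij hjk hik (p ^ e) (hchart t ht) (W.b t) (W.onExc t) (hP t ht).2 (W.st t) (hF t)
  have hstepE : ∀ t, N ≤ t →
      excLetters (step (p ^ e) (idx i (W.j t)) (ι K ∘ secPt i j (W.b t)) (G t)) = excLetters (G (t + 1)) := by
    intro t ht
    show _ = excLetters (secState i j k (W.st (t + 1)))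
    rw [W.st_succ]
    exact excLetters_secState_step hij hjk hik (p ^ e) (hchart t ht) (W.b t) (W.st t) (hord t ht) (h0 t ht)
  have hequi : ∀ t, N ≤ t → IsEquimultiplePoint (p ^ e) (idx i (W.j t)) (ι K ∘ secPt i j (W.b t)) (G t) :=
    fun t ht => isEquimultiplePoint_secState hij hjk hik (p ^ e) (hchart t ht) (W.b t) (W.onExc t) (hP t ht).2
      (W.st t) (hF t) (W.equimult t)
  -- Prop. 3: the flag invariant of every section state from `N` on
  have hex3 : ∀ n, ∃ v : Triple, IsFlagInvariant (p ^ e) (excLetters (G (N + n))) (G (N + n)).F v := fun n =>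
    hP3 p hp e he1 (Kbar K) (G (N + n)) (hGne _ (by omega)) (hGclean _) (hGord _ (by omega)) (hNT _ (by omega))
  choose v hv using hex3
  -- Prop. 4: it drops at every move of the section walk
  refine no_strictAnti_triple v fun n => ?_
  have h4 := hP4 p hp e he1 (Kbar K) (G (N + n)) (idx i (W.j (N + n))) (ι K ∘ secPt i j (W.b (N + n))) (v n)
    (v (n + 1)) (hGne _ (by omega)) (hGclean _) (hGord _ (by omega)) (hequi _ (by omega)) (hNT _ (by omega))
  rw [hstepE _ (by omega), ← hstepF _ (by omega)] at h4
  exact h4 (hNT (N + n + 1) (by omega)) (hv n) (hv (n + 1))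

/-- RESIDUAL CLASS · LOCATED · **MONOMIAL PLANAR TAILS WITH RECURRENTLY TERMINAL PLANE SECTION.**  VERBATIM the port class
plus TWO binders: (L) from `N` on the wall layer `0` is NOT monomial-led (no componentwise-least exponent in `(d_i, d_j)`)
— PROVED for every tail of the port class (`layer_zero_not_monomialLed`, hypothesis-free), so the binder only RECORDS the
law; (T) the section state is in a terminal case of [HP24] §3 (monomial or small-residual up to a subordinate triangular
change over `K̄`, `IsTerminalSub`) at INFINITELY MANY `t`.  Tags: POINTER(cite: BenitoVillamayor2012 §4 monomial case;
KawanoueMatsuki2016 §5; [HP24] §3 p. 775 "the terminal cases are resolved by combinatorial blow-ups") · WEAKER (sub-case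
of the port class BY LETTER, `terminalSection_of_monomialLed`; probe P2 must-fail) · leaf ATTACKABLE (T-planar-3: every
one of the 53 translated in-stretch moves of the bed is an entrance; binder (L) holds on 53/53 by the law). -/
def NoTerminalSectionPlanarJointTailsDeep : Prop :=
  ∀ p : ℕ, p.Prime → ∀ e : ℕ, 2 ≤ e → ∀ (K : Type) [Field K] [CharP K p] [PerfectField K] [DecidableEq K]
    (s₀ : State (Fin 3) K), IsRoot (p ^ e) s₀ → ∀ W : ForcedWalk (p ^ e) s₀, (∀ i, 1 ≤ (W.st i).shade) →
    ∀ N : ℕ, (∀ t, N ≤ t → (W.st (t + 1)).shade = (W.st t).shade) →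
    (∀ t, N ≤ t → ordZero (W.st t).F ≠ ((p ^ e : ℕ) : ℕ∞)) →
    (∀ M : ℕ, ∃ t, M ≤ t ∧ StaysOnNewest W t) → (∀ M : ℕ, ∃ t, M ≤ t ∧ W.b t ≠ 0) →
    ∀ (i j k : Fin 3), i ≠ j → j ≠ k → i ≠ k → (∀ t, N ≤ t → W.j t ≠ k ∧ W.b t k = 0) →
    (∀ t, N ≤ t → ∃ d ∈ (W.st t).F.support, d k = 0) →
    (∀ t, N ≤ t → ∀ a, 1 ≤ a → a < p ^ e →
      IsMonomialLed (((W.st t).F.support).filter (fun d => d k = a)) i j) →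
    (∀ t, N ≤ t → ¬ IsMonomialLed (((W.st t).F.support).filter (fun d => d k = 0)) i j) →
    (∀ M : ℕ, ∃ t, M ≤ t ∧ IsTerminalSub (p ^ e) (excLetters (secState i j k (W.st t))) (secState i j k (W.st t)).F) →
    False

/-- NECESSITY: the terminal residual is a sub-case of the port class BY LETTER. [folklore] -/
theorem terminalSection_of_monomialLed (h : NoMonomialLedPlanarJointTailsDeep) : NoTerminalSectionPlanarJointTailsDeep :=
  fun p hp e he K _ _ _ _ s₀ hs W hsh N hpl hex hS hb i j k hij hjk hik hP h0 hled _ _ =>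
    h p hp e he K s₀ hs W hsh N hpl hex hS hb i j k hij hjk hik hP h0 hled

/-- **EXACT SPLIT OF THE PLANAR PORT (PROVED, hypothesis-free):** port class `⟺` H-P half `∧` terminal residual
(the law supplies binder (L); excluded middle on «the section is terminal infinitely often»; an eventually non-terminal
tail is the H-P half from `max N M` on). [new] [folklore] -/
theorem monomialLed_iff_nonTerminal_terminal : NoMonomialLedPlanarJointTailsDeep ↔
    NoNonTerminalSectionPlanarJointTailsDeep ∧ NoTerminalSectionPlanarJointTailsDeep := by
  refine ⟨fun h => ⟨nonTerminalSection_of_monomialLed h, terminalSection_of_monomialLed h⟩, fun ⟨hN, hT⟩ => ?_⟩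
  intro p hp e he K _ _ _ _ s₀ hs W hsh N hpl hex hS hb i j k hij hjk hik hP h0 hled
  classical
  have hlaw : ∀ t, N ≤ t → ¬ IsMonomialLed (((W.st t).F.support).filter (fun d => d k = 0)) i j := by
    intro t ht hml
    exact layer_zero_not_monomialLed hij hjk hik hs W hP h0
      (fun t ht a ha1 haq => (sm_eq_zero_iff_isMonomialLed (layer k a (W.st t).F) i j).mpr (hled t ht a ha1 haq)) hb t ht
      ((sm_eq_zero_iff_isMonomialLed (layer k 0 (W.st t).F) i j).mpr hml)
  by_cases hio : ∀ M : ℕ, ∃ t, M ≤ t ∧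
      IsTerminalSub (p ^ e) (excLetters (secState i j k (W.st t))) (secState i j k (W.st t)).F
  · exact hT p hp e he K s₀ hs W hsh N hpl hex hS hb i j k hij hjk hik hP h0 hled hlaw hio
  · push Not at hio
    obtain ⟨M, hM⟩ := hio
    exact hN p hp e he K s₀ hs W hsh (max N M) (fun t ht => hpl t (le_of_max_le_left ht))
      (fun t ht => hex t (le_of_max_le_left ht)) hS hb i j k hij hjk hik (fun t ht => hP t (le_of_max_le_left ht))
      (fun t ht => h0 t (le_of_max_le_left ht)) (fun t ht => hled t (le_of_max_le_left ht))
      (fun t ht => hM t (le_of_max_le_right ht))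

/-- NECESSITY from the host target. [folklore] -/
theorem terminalSection_of_defectWalksDeep (h : MaxContactCut.DefectWalksDeep) : NoTerminalSectionPlanarJointTailsDeep :=
  terminalSection_of_monomialLed (monomialLed_of_defectWalksDeep h)

/-- NECESSITY from the host target. [folklore] -/
theorem nonTerminalSection_of_defectWalksDeep (h : MaxContactCut.DefectWalksDeep) :
    NoNonTerminalSectionPlanarJointTailsDeep :=
  nonTerminalSection_of_monomialLed (monomialLed_of_defectWalksDeep h)

/-- **THE NODE EQUATION (PROVED, hypothesis-free, EXACT):** `MaxContactCut.DefectWalksDeep` (31770) `⟺` deep arc law `∧`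
(H-P half `∧` terminal residual of the planar port) `∧` positive skew leaf `∧` null-flat skew leaf (tree rev 8 of the
StallVertex node for the skew side). [new] [folklore] -/
theorem defectWalksDeep_iff_planarPort : MaxContactCut.DefectWalksDeep ↔
    NoFreePointTailsDeep ∧ (NoNonTerminalSectionPlanarJointTailsDeep ∧ NoTerminalSectionPlanarJointTailsDeep) ∧
      StallVertex.NoPositiveSkewStalledTailsDeep ∧ StallVertex.NoNullFlatSkewStalledTailsDeep := by
  rw [StallVertex.defectWalksDeep_iff_positive_nullFlat, planar_iff_monomial, monomialPlanar_iff_monomialLed,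
    monomialLed_iff_nonTerminal_terminal]

/-- **`closes` (PROVED modulo [HP24] Prop. 3 + Prop. 4 as named propositions):** deep arc law `∧` terminal residual `∧`
skew residual `⟹ MaxContactCut.DefectWalksDeep` — 31770 BY NAME, through the tree's `CoefficientCut.closes_led`. [folklore] -/
theorem closes_planarPort (hA : NoFreePointTailsDeep) (hP3 : HP24Prop3) (hP4 : HP24Prop4)
    (hT : NoTerminalSectionPlanarJointTailsDeep) (hR : NoSkewJointTailsDeep) : MaxContactCut.DefectWalksDeep :=
  closes_led hA (monomialLed_iff_nonTerminal_terminal.mpr ⟨nonTerminalSection_of_HP hP3 hP4, hT⟩) hR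

/-- `closes` on the current leaves of the skew side (tree `StallVertex.closes_positive_nullFlat`). [folklore] -/
theorem closes_planarPort_leaves (hA : NoFreePointTailsDeep) (hP3 : HP24Prop3) (hP4 : HP24Prop4)
    (hT : NoTerminalSectionPlanarJointTailsDeep) (hI : StallVertex.NoPositiveSkewStalledTailsDeep)
    (hZ : StallVertex.NoNullFlatSkewStalledTailsDeep) : MaxContactCut.DefectWalksDeep :=
  defectWalksDeep_iff_planarPort.mpr ⟨hA, ⟨nonTerminalSection_of_HP hP3 hP4, hT⟩, hI, hZ⟩

/-- The node equation modulo [HP24]: the planar port is REDUCED to its terminal residual. [folklore] -/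
theorem defectWalksDeep_iff_of_HP (hP3 : HP24Prop3) (hP4 : HP24Prop4) : MaxContactCut.DefectWalksDeep ↔
    NoFreePointTailsDeep ∧ NoTerminalSectionPlanarJointTailsDeep ∧
      StallVertex.NoPositiveSkewStalledTailsDeep ∧ StallVertex.NoNullFlatSkewStalledTailsDeep := by
  rw [defectWalksDeep_iff_planarPort]
  exact ⟨fun ⟨hA, ⟨_, hT⟩, hI, hZ⟩ => ⟨hA, hT, hI, hZ⟩,
    fun ⟨hA, hT, hI, hZ⟩ => ⟨hA, ⟨nonTerminalSection_of_HP hP3 hP4, hT⟩, hI, hZ⟩⟩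

end Classes

end Summit.ResolutionOfSingularities.ResolutionOfSingularities.Theorems.PlanarPort
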